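import Summits.KontsevichZagierPeriods.KontsevichZagierPeriods.Theorems.RealOnePeriodRelations.Negative.Kit
import Literature.NumberTheory.Transcendental.SemialgebraicMapsProofs

/-!
# `RealOnePeriodRelations` (stmt-KontsevichZagierPeriods-10042) — negative side: the Green generator
# SUBSUMES integrand additivity (1b) on continuous unit-interval data

Load-bearing analysis of the conclusion subgroup `M₁ = closure (1a ∪ 1b ∪ 2 ∪ Green)` of the crux,
continued: in contrast with rule 2 (`Negative/Localisation`: load-bearing), rule 1b is NOT
load-bearing on the data the transport actually produces. For `f₁, f₂` `ℚ`-semialgebraic and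
continuous on `[0,1]`, the 1b instance `[∫₀¹ (f₁+f₂)] − [∫₀¹ f₁] − [∫₀¹ f₂]` is an EXACT signed sum of
THREE Green instances (no rule 2, no 1a, no 1b):
* `S₁(a,b) = F₁(a) + F₂(a+b)` (`Fᵢ' = fᵢ`): edge densities `f₁ + f₂`, `−f₁(1−t)`, `f₂`;
* `S₂(a,b) = F₁(a)`: edge densities `f₁`, `−f₁(1−t)`, `0`;
* `S₃ = 0`: the element `[∫₀¹ 0]`;
and `G₁ − G₂ − G₃ = [f₁+f₂] − [f₁] − [f₂]` in the free group (`integrandAdd_mem_closure_greenSet`).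
The potentials are only `C¹` on the open triangle (primitives of continuous functions), exactly what
the typed generator allows. Moral for provers: Green potentials of the shape `F₁(a) + F₂(a+b)` do the
(ℚ̄ ∩ ℝ)-linear bookkeeping; moral for the `NoGreen` question (`Disproof.lean` §5): Green is strictly
more than a homotopy move. [Kontsevich–Zagier 2001, §1.2]
-/

noncomputable section

open scoped BigOperators Topology
open Set MeasureTheory Filter
open Literature.NumberTheory.Transcendental

namespace Summit.KontsevichZagierPeriods.SymplecticScissors.RealOnePeriodRelationsNegative

/-! ## One-variable continuous semialgebraic data -/

/-- The closed unit interval as a subset of `ℝ¹`. [folklore] -/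
def unitIcc : Set (Fin 1 → ℝ) := {z | z 0 ∈ Set.Icc 0 1}

/-- `unitIcc` is `ℚ`-semialgebraic. [folklore] -/
theorem isSemialgebraic_unitIcc : Literature.ModelTheory.ExponentialFields.IsSemialgebraic ℚ unitIcc := by
  have h1 := Literature.ModelTheory.ExponentialFields.isSemialgebraic_setOf_eval_nonneg (k := ℚ)
    (R := ℝ) (MvPolynomial.X (0 : Fin 1) : MvPolynomial (Fin 1) ℚ)
  have h2 := Literature.ModelTheory.ExponentialFields.isSemialgebraic_setOf_eval_le (k := ℚ)
    (R := ℝ) (MvPolynomial.X (0 : Fin 1) : MvPolynomial (Fin 1) ℚ) 1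
  have h : unitIcc = {x : Fin 1 → ℝ | 0 ≤ MvPolynomial.aeval x (MvPolynomial.X (0 : Fin 1) : MvPolynomial (Fin 1) ℚ)} ∩
      {x : Fin 1 → ℝ | MvPolynomial.aeval x (MvPolynomial.X (0 : Fin 1) : MvPolynomial (Fin 1) ℚ) ≤
        MvPolynomial.aeval x (1 : MvPolynomial (Fin 1) ℚ)} := by
    ext z
    simp [unitIcc]
  rw [h]
  exact h1.inter h2

/-- `unitIcc` is compact (preimage of `[0,1]` under `ℝ¹ ≃ₜ ℝ`). [folklore] -/
theorem isCompact_unitIcc : IsCompact unitIcc := by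
  have h : unitIcc = (Homeomorph.funUnique (Fin 1) ℝ) ⁻¹' Set.Icc 0 1 := by
    ext z
    simp [unitIcc, Homeomorph.funUnique, Fin.default_eq_zero]
  rw [h]
  exact (Homeomorph.isCompact_preimage _).mpr isCompact_Icc

/-- `unitDom ⊆ unitIcc`. [folklore] -/
theorem unitDom_subset_unitIcc : unitDom ⊆ unitIcc := fun _ hz => Ioo_subset_Icc_self hz

/-- `Δ` is `ℚ`-semialgebraic. [folklore] -/
theorem isSemialgebraic_Δ' : Literature.ModelTheory.ExponentialFields.IsSemialgebraic ℚ Δ := by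
  have h0 := Literature.ModelTheory.ExponentialFields.isSemialgebraic_setOf_eval_nonneg (k := ℚ)
    (R := ℝ) (MvPolynomial.X (0 : Fin 2) : MvPolynomial (Fin 2) ℚ)
  have h1 := Literature.ModelTheory.ExponentialFields.isSemialgebraic_setOf_eval_nonneg (k := ℚ)
    (R := ℝ) (MvPolynomial.X (1 : Fin 2) : MvPolynomial (Fin 2) ℚ)
  have h2 := Literature.ModelTheory.ExponentialFields.isSemialgebraic_setOf_eval_le (k := ℚ)
    (R := ℝ) (MvPolynomial.X (0 : Fin 2) + MvPolynomial.X 1 : MvPolynomial (Fin 2) ℚ) 1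
  have hΔ : Δ = ({x : Fin 2 → ℝ | 0 ≤ MvPolynomial.aeval x (MvPolynomial.X (0 : Fin 2) : MvPolynomial (Fin 2) ℚ)} ∩
      {x : Fin 2 → ℝ | 0 ≤ MvPolynomial.aeval x (MvPolynomial.X (1 : Fin 2) : MvPolynomial (Fin 2) ℚ)}) ∩
      {x : Fin 2 → ℝ | MvPolynomial.aeval x (MvPolynomial.X (0 : Fin 2) + MvPolynomial.X 1 : MvPolynomial (Fin 2) ℚ) ≤
        MvPolynomial.aeval x (1 : MvPolynomial (Fin 2) ℚ)} := by
    ext p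
    simp [Δ, and_assoc]
  rw [hΔ]
  exact (h0.inter h1).inter h2

/-- Composition of one-variable semialgebraic data with the coordinate `p ↦ p 0` on `Δ`. [folklore] -/
theorem isSemialgebraicFunOn_comp_fst {f : ℝ → ℝ}
    (hf : IsSemialgebraicFunOn ℚ unitIcc (fun z => f (z 0))) :
    IsSemialgebraicFunOn ℚ Δ (fun p => f (p 0)) := by
  have hP := isSemialgebraicMapOn_aeval (k := ℚ) (R := ℝ) isSemialgebraic_Δ'
    (![MvPolynomial.X 0] : Fin 1 → MvPolynomial (Fin 2) ℚ)
  have hmaps : MapsTo (fun x : Fin 2 → ℝ => fun j : Fin 1 =>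
      MvPolynomial.aeval x ((![MvPolynomial.X 0] : Fin 1 → MvPolynomial (Fin 2) ℚ) j)) Δ unitIcc := by
    intro p hp
    simp only [unitIcc, mem_setOf_eq, Matrix.cons_val_zero, MvPolynomial.aeval_X, mem_Icc]
    exact ⟨hp.1, by linarith [hp.2.1, hp.2.2]⟩
  have h := IsSemialgebraicFunOn.comp_isSemialgebraicMapOn_holds hf hP hmaps
  refine h.congr fun p _ => ?_
  simp

/-- Composition of one-variable semialgebraic data with `p ↦ p 0 + p 1` on `Δ`. [folklore] -/
theorem isSemialgebraicFunOn_comp_sum {f : ℝ → ℝ}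
    (hf : IsSemialgebraicFunOn ℚ unitIcc (fun z => f (z 0))) :
    IsSemialgebraicFunOn ℚ Δ (fun p => f (p 0 + p 1)) := by
  have hP := isSemialgebraicMapOn_aeval (k := ℚ) (R := ℝ) isSemialgebraic_Δ'
    (![MvPolynomial.X 0 + MvPolynomial.X 1] : Fin 1 → MvPolynomial (Fin 2) ℚ)
  have hmaps : MapsTo (fun x : Fin 2 → ℝ => fun j : Fin 1 =>
      MvPolynomial.aeval x ((![MvPolynomial.X 0 + MvPolynomial.X 1] : Fin 1 → MvPolynomial (Fin 2) ℚ) j))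
      Δ unitIcc := by
    intro p hp
    simp only [unitIcc, mem_setOf_eq, Matrix.cons_val_zero, map_add, MvPolynomial.aeval_X, mem_Icc]
    exact ⟨by linarith [hp.1, hp.2.1], hp.2.2⟩
  have h := IsSemialgebraicFunOn.comp_isSemialgebraicMapOn_holds hf hP hmaps
  refine h.congr fun p _ => ?_
  simp

/-- Composition of one-variable semialgebraic data with the reflection `z ↦ 1 − z 0` on `unitDom`,
negated: `z ↦ −f(1 − z 0)`. [folklore] -/
theorem isSemialgebraicFunOn_reflNeg {f : ℝ → ℝ}
    (hf : IsSemialgebraicFunOn ℚ unitIcc (fun z => f (z 0))) :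
    IsSemialgebraicFunOn ℚ unitDom (fun z => -f (1 - z 0)) := by
  have hP := isSemialgebraicMapOn_aeval (k := ℚ) (R := ℝ) isSemialgebraic_unitDom
    (![1 - MvPolynomial.X 0] : Fin 1 → MvPolynomial (Fin 1) ℚ)
  have hmaps : MapsTo (fun x : Fin 1 → ℝ => fun j : Fin 1 =>
      MvPolynomial.aeval x ((![1 - MvPolynomial.X 0] : Fin 1 → MvPolynomial (Fin 1) ℚ) j))
      unitDom unitIcc := by
    intro z hz
    simp only [unitDom, mem_setOf_eq, mem_Ioo] at hz
    simp only [unitIcc, mem_setOf_eq, Matrix.cons_val_zero, map_sub, map_one, MvPolynomial.aeval_X,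
      mem_Icc]
    constructor <;> linarith
  have h := (IsSemialgebraicFunOn.comp_isSemialgebraicMapOn_holds hf hP hmaps).neg
  refine h.congr fun z _ => ?_
  simp

/-- Continuity of `z ↦ −f(1 − z 0)` on `unitIcc`. [folklore] -/
theorem continuousOn_reflNeg {f : ℝ → ℝ} (hc : ContinuousOn f (Set.Icc 0 1)) :
    ContinuousOn (fun z : Fin 1 → ℝ => -f (1 - z 0)) unitIcc := by
  refine (hc.comp (continuous_const.sub (continuous_apply 0)).continuousOn ?_).neg
  intro z hz
  simp only [unitIcc, mem_setOf_eq, mem_Icc] at hz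
  constructor <;> linarith [hz.1, hz.2]

/-- The representation `[∫₀¹ −f(1−t) dt]` for `f` semialgebraic and continuous on `[0,1]` — the common
hypotenuse term of the two Green instances below. [folklore] -/
def reflNegRep (f : ℝ → ℝ) (hf : IsSemialgebraicFunOn ℚ unitIcc (fun z => f (z 0)))
    (hc : ContinuousOn f (Set.Icc 0 1)) : KZ.IntegralRep 1 where
  domain := unitDom
  integrand := fun z => -f (1 - z 0)
  isSemialgebraic_domain := isSemialgebraic_unitDom
  isSemialgebraicFunOn_integrand := isSemialgebraicFunOn_reflNeg hf
  integrableOn :=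
    ((continuousOn_reflNeg hc).integrableOn_compact isCompact_unitIcc).mono_set unitDom_subset_unitIcc

/-! ## Primitives of continuous functions on `(0,1)` -/

/-- The primitive `F x = ∫₀ˣ f` of a function continuous on `[0,1]` has derivative `f x` at every
`x ∈ (0,1)`. [folklore] -/
theorem hasDerivAt_primitive {f : ℝ → ℝ} (hc : ContinuousOn f (Set.Icc 0 1)) {x : ℝ}
    (hx : x ∈ Set.Ioo (0:ℝ) 1) : HasDerivAt (fun u => ∫ t in (0:ℝ)..u, f t) (f x) x := by
  have hint : IntervalIntegrable f volume 0 x := by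
    refine (hc.mono ?_).intervalIntegrable
    rw [uIcc_of_le hx.1.le]
    exact Icc_subset_Icc_right hx.2.le
  have hmeas : StronglyMeasurableAtFilter f (𝓝 x) volume :=
    ContinuousOn.stronglyMeasurableAtFilter isOpen_Ioo (hc.mono Ioo_subset_Icc_self) x hx
  have hcont : ContinuousAt f x := hc.continuousAt (Icc_mem_nhds hx.1 hx.2)
  exact intervalIntegral.integral_hasDerivAt_right hint hmeas hcont

/-- The potential `S(a,b) = F₁(a) + F₂(a+b)` has derivative `(f₁(a) + f₂(a+b)) da + f₂(a+b) db` on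
the open triangle. [folklore] -/
theorem hasFDerivAt_potential₁ {f₁ f₂ : ℝ → ℝ} (hc₁ : ContinuousOn f₁ (Set.Icc 0 1))
    (hc₂ : ContinuousOn f₂ (Set.Icc 0 1)) (p : Fin 2 → ℝ) (h0 : 0 < p 0) (h1 : 0 < p 1)
    (h2 : p 0 + p 1 < 1) :
    HasFDerivAt (fun p : Fin 2 → ℝ => (∫ t in (0:ℝ)..(p 0), f₁ t) + ∫ t in (0:ℝ)..(p 0 + p 1), f₂ t)
      ((f₁ (p 0) + f₂ (p 0 + p 1)) • ContinuousLinearMap.proj (R := ℝ) (φ := fun _ : Fin 2 => ℝ) 0 +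
        f₂ (p 0 + p 1) • ContinuousLinearMap.proj (R := ℝ) (φ := fun _ : Fin 2 => ℝ) 1) p := by
  have hproj0 : HasFDerivAt (fun q : Fin 2 → ℝ => q 0)
      (ContinuousLinearMap.proj (R := ℝ) (φ := fun _ : Fin 2 => ℝ) 0) p := hasFDerivAt_apply 0 p
  have hsum : HasFDerivAt (fun q : Fin 2 → ℝ => q 0 + q 1)
      (ContinuousLinearMap.proj (R := ℝ) (φ := fun _ : Fin 2 => ℝ) 0 +
        ContinuousLinearMap.proj (R := ℝ) (φ := fun _ : Fin 2 => ℝ) 1) p :=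
    (hasFDerivAt_apply 0 p).add (hasFDerivAt_apply 1 p)
  have hF₁ : HasDerivAt (fun u => ∫ t in (0:ℝ)..u, f₁ t) (f₁ (p 0)) (p 0) :=
    hasDerivAt_primitive hc₁ ⟨h0, by linarith⟩
  have hF₂ : HasDerivAt (fun u => ∫ t in (0:ℝ)..u, f₂ t) (f₂ (p 0 + p 1)) (p 0 + p 1) :=
    hasDerivAt_primitive hc₂ ⟨by linarith, h2⟩
  have hA := hF₁.comp_hasFDerivAt p hproj0
  have hB := hF₂.comp_hasFDerivAt p hsum
  refine (hA.add hB).congr_fderiv (ContinuousLinearMap.ext fun v => ?_)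
  simp only [smul_add]
  simp [smul_eq_mul]
  ring

/-- The potential `S(a,b) = F₁(a)` has derivative `f₁(a) da + 0 db` on the open triangle. [folklore] -/
theorem hasFDerivAt_potential₂ {f₁ : ℝ → ℝ} (hc₁ : ContinuousOn f₁ (Set.Icc 0 1))
    (p : Fin 2 → ℝ) (h0 : 0 < p 0) (_h1 : 0 < p 1) (h2 : p 0 + p 1 < 1) :
    HasFDerivAt (fun p : Fin 2 → ℝ => ∫ t in (0:ℝ)..(p 0), f₁ t)
      (f₁ (p 0) • ContinuousLinearMap.proj (R := ℝ) (φ := fun _ : Fin 2 => ℝ) 0 +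
        (0:ℝ) • ContinuousLinearMap.proj (R := ℝ) (φ := fun _ : Fin 2 => ℝ) 1) p := by
  have hproj0 : HasFDerivAt (fun q : Fin 2 → ℝ => q 0)
      (ContinuousLinearMap.proj (R := ℝ) (φ := fun _ : Fin 2 => ℝ) 0) p := hasFDerivAt_apply 0 p
  have hF₁ : HasDerivAt (fun u => ∫ t in (0:ℝ)..u, f₁ t) (f₁ (p 0)) (p 0) :=
    hasDerivAt_primitive hc₁ ⟨h0, by linarith⟩
  have hA := hF₁.comp_hasFDerivAt p hproj0
  refine hA.congr_fderiv ?_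
  simp

/-! ## The three Green instances and the conclusion -/

/-- FIRST GREEN INSTANCE `S₁ = F₁(a) + F₂(a+b)`: `[∫(f₁+f₂)] + [∫ −f₁(1−t)] − [∫ f₂] ∈ greenSet`.
[cite: KontsevichZagier2001, §1.2] -/
theorem green₁_mem {f₁ f₂ : ℝ → ℝ}
    (hs₁ : IsSemialgebraicFunOn ℚ unitIcc (fun z => f₁ (z 0)))
    (hs₂ : IsSemialgebraicFunOn ℚ unitIcc (fun z => f₂ (z 0)))
    (hc₁ : ContinuousOn f₁ (Set.Icc 0 1)) (hc₂ : ContinuousOn f₂ (Set.Icc 0 1))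
    (r r₂ : KZ.IntegralRep 1) (hd : r.domain = unitDom) (hd₂ : r₂.domain = unitDom)
    (hi : ∀ z ∈ r.domain, r.integrand z = f₁ (z 0) + f₂ (z 0))
    (hi₂ : ∀ z ∈ r₂.domain, r₂.integrand z = f₂ (z 0)) :
    KZ.of r + KZ.of (reflNegRep f₁ hs₁ hc₁) - KZ.of r₂ ∈ greenSet := by
  refine ⟨Δ, fun p => f₁ (p 0) + f₂ (p 0 + p 1), fun p => f₂ (p 0 + p 1),
    fun p => (∫ t in (0:ℝ)..(p 0), f₁ t) + ∫ t in (0:ℝ)..(p 0 + p 1), f₂ t,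
    r, reflNegRep f₁ hs₁ hc₁, r₂, rfl,
    IsSemialgebraicFunOn.add_holds (isSemialgebraicFunOn_comp_fst hs₁) (isSemialgebraicFunOn_comp_sum hs₂),
    isSemialgebraicFunOn_comp_sum hs₂, ?_, ?_, hasFDerivAt_potential₁ hc₁ hc₂, hd, rfl, hd₂, ?_, ?_, ?_, rfl⟩
  · refine ContinuousOn.add ?_ ?_
    · refine hc₁.comp (continuous_apply 0).continuousOn fun p hp => ?_
      exact ⟨hp.1, by linarith [hp.2.1, hp.2.2]⟩
    · refine hc₂.comp ((continuous_apply 0).add (continuous_apply 1)).continuousOn fun p hp => ?_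
      exact ⟨by linarith [hp.1, hp.2.1], hp.2.2⟩
  · refine hc₂.comp ((continuous_apply 0).add (continuous_apply 1)).continuousOn fun p hp => ?_
    exact ⟨by linarith [hp.1, hp.2.1], hp.2.2⟩
  · intro z hz
    simp [hi z hz]
  · intro z _
    simp [reflNegRep]
  · intro z hz
    simp [hi₂ z hz]

/-- SECOND GREEN INSTANCE `S₂ = F₁(a)`: `[∫ f₁] + [∫ −f₁(1−t)] − [∫ 0] ∈ greenSet`.
[cite: KontsevichZagier2001, §1.2] -/
theorem green₂_mem {f₁ : ℝ → ℝ}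
    (hs₁ : IsSemialgebraicFunOn ℚ unitIcc (fun z => f₁ (z 0))) (hc₁ : ContinuousOn f₁ (Set.Icc 0 1))
    (r₁ : KZ.IntegralRep 1) (hd₁ : r₁.domain = unitDom)
    (hi₁ : ∀ z ∈ r₁.domain, r₁.integrand z = f₁ (z 0)) :
    KZ.of r₁ + KZ.of (reflNegRep f₁ hs₁ hc₁) - KZ.of (constRep₁ 0) ∈ greenSet := by
  refine ⟨Δ, fun p => f₁ (p 0), fun _ => 0, fun p => ∫ t in (0:ℝ)..(p 0), f₁ t,
    r₁, reflNegRep f₁ hs₁ hc₁, constRep₁ 0, rfl, isSemialgebraicFunOn_comp_fst hs₁,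
    isSemialgebraicFunOn_ratConst isSemialgebraic_Δ' 0 |>.congr fun _ _ => by simp,
    ?_, continuousOn_const, hasFDerivAt_potential₂ hc₁, hd₁, rfl, rfl, ?_, ?_, ?_, rfl⟩
  · refine hc₁.comp (continuous_apply 0).continuousOn fun p hp => ?_
    exact ⟨hp.1, by linarith [hp.2.1, hp.2.2]⟩
  · intro z hz
    simp [hi₁ z hz]
  · intro z _
    simp [reflNegRep]
  · intro z _
    simp

/-- THIRD GREEN INSTANCE `S₃ = 0`: `[∫₀¹ 0] ∈ greenSet` (all three edge representations equal).
[cite: KontsevichZagier2001, §1.2] -/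
theorem green₃_mem : KZ.of (constRep₁ 0) ∈ greenSet := by
  refine ⟨Δ, fun _ => 0, fun _ => 0, fun _ => 0, constRep₁ 0, constRep₁ 0, constRep₁ 0, rfl,
    isSemialgebraicFunOn_ratConst isSemialgebraic_Δ' 0 |>.congr fun _ _ => by simp,
    isSemialgebraicFunOn_ratConst isSemialgebraic_Δ' 0 |>.congr fun _ _ => by simp,
    continuousOn_const, continuousOn_const, ?_, rfl, rfl, rfl, ?_, ?_, ?_, by abel⟩
  · intro p _ _ _
    have h : HasFDerivAt (fun _ : Fin 2 → ℝ => (0:ℝ)) (0 : (Fin 2 → ℝ) →L[ℝ] ℝ) p :=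
      hasFDerivAt_const (0:ℝ) p
    refine h.congr_fderiv ?_
    simp
  · intro z _; simp
  · intro z _; simp
  · intro z _; simp

/-- **Green subsumes 1b on continuous unit-interval data.** For `f₁, f₂` `ℚ`-semialgebraic and
continuous on `[0,1]`, the integrand-additivity instance `[∫₀¹(f₁+f₂)] − [∫₀¹f₁] − [∫₀¹f₂]` lies in the
subgroup generated by the Green generator ALONE: it equals `G₁ − G₂ − G₃` for the three instances above.
So rule 1b is not load-bearing for such data (any proof may trade it for Green potentials
`F₁(a) + F₂(a+b)`), in contrast with rule 2 (`realOnePeriodRelations_false_without_rule2`).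
[cite: KontsevichZagier2001, §1.2] -/
theorem integrandAdd_mem_closure_greenSet {f₁ f₂ : ℝ → ℝ}
    (hs₁ : IsSemialgebraicFunOn ℚ unitIcc (fun z => f₁ (z 0)))
    (hs₂ : IsSemialgebraicFunOn ℚ unitIcc (fun z => f₂ (z 0)))
    (hc₁ : ContinuousOn f₁ (Set.Icc 0 1)) (hc₂ : ContinuousOn f₂ (Set.Icc 0 1))
    (r r₁ r₂ : KZ.IntegralRep 1) (hd : r.domain = unitDom) (hd₁ : r₁.domain = unitDom)
    (hd₂ : r₂.domain = unitDom) (hi : ∀ z ∈ r.domain, r.integrand z = f₁ (z 0) + f₂ (z 0))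
    (hi₁ : ∀ z ∈ r₁.domain, r₁.integrand z = f₁ (z 0)) (hi₂ : ∀ z ∈ r₂.domain, r₂.integrand z = f₂ (z 0)) :
    KZ.of r - KZ.of r₁ - KZ.of r₂ ∈ AddSubgroup.closure greenSet := by
  have h₁ := AddSubgroup.subset_closure (green₁_mem hs₁ hs₂ hc₁ hc₂ r r₂ hd hd₂ hi hi₂)
  have h₂ := AddSubgroup.subset_closure (green₂_mem hs₁ hc₁ r₁ hd₁ hi₁)
  have h₃ : KZ.of (constRep₁ 0) ∈ AddSubgroup.closure greenSet := AddSubgroup.subset_closure green₃_mem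
  have h := (AddSubgroup.closure greenSet).sub_mem ((AddSubgroup.closure greenSet).sub_mem h₁ h₂) h₃
  convert h using 1
  abel

/-- Hence such 1b instances lie in `M₁` through Green alone. [cite: KontsevichZagier2001, §1.2] -/
theorem integrandAdd_mem_M₁_via_green {f₁ f₂ : ℝ → ℝ}
    (hs₁ : IsSemialgebraicFunOn ℚ unitIcc (fun z => f₁ (z 0)))
    (hs₂ : IsSemialgebraicFunOn ℚ unitIcc (fun z => f₂ (z 0)))
    (hc₁ : ContinuousOn f₁ (Set.Icc 0 1)) (hc₂ : ContinuousOn f₂ (Set.Icc 0 1))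
    (r r₁ r₂ : KZ.IntegralRep 1) (hd : r.domain = unitDom) (hd₁ : r₁.domain = unitDom)
    (hd₂ : r₂.domain = unitDom) (hi : ∀ z ∈ r.domain, r.integrand z = f₁ (z 0) + f₂ (z 0))
    (hi₁ : ∀ z ∈ r₁.domain, r₁.integrand z = f₁ (z 0)) (hi₂ : ∀ z ∈ r₂.domain, r₂.integrand z = f₂ (z 0)) :
    KZ.of r - KZ.of r₁ - KZ.of r₂ ∈ M₁ :=
  AddSubgroup.closure_mono (fun _ h => Or.inr h)
    (integrandAdd_mem_closure_greenSet hs₁ hs₂ hc₁ hc₂ r r₁ r₂ hd hd₁ hd₂ hi hi₁ hi₂)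

end Summit.KontsevichZagierPeriods.SymplecticScissors.RealOnePeriodRelationsNegative

end
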